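import Literature.Geometry.Symplectic.SphereCROperatorPointwise
import Mathlib.Topology.Algebra.Module.FiniteDimension
import Mathlib.Analysis.Normed.Ring.Units
import Mathlib.Analysis.Normed.Operator.Prod
import HarnessLib

/-!
# The Cauchy–Riemann operator of a sphere: jet form and invertibility of the transport

Sequel to `SphereCROperatorPointwise.lean` (layer B4b of the analytic core of the
Hofer–Lizan–Sikorav theorem, Wendl 2018 Thm. 2.46; lead of crux `WitnessCharge`, summit
`SmoothPoincare4`). Two facts that turn the pointwise operator `crOp₀ ξ f z` into a smooth
Nemytskii operator on Hölder spaces with the right zero set: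

* **Jet form.** There is an explicit smooth map `jetOp₀ 𝒥` of the jet variables
  `(z, c, c', t, t') = (z, ξ z, Dξ(z), f z, Df(z))`, defined and `C^∞` on the open set
  `{den z c ≠ 0}`, with `crOp₀ ξ f z = jetOp₀ 𝒥 (z, ξ z, Dξ z, f z, Df z)` whenever `ξ`, `f`
  are differentiable at `z` (`crOp₀_eq_jetOp₀`, `contDiffOn_jetOp₀`); likewise in chart `1`.
* **Invertibility of the transport near the zero section.** The transport `Φ₀` is an
  invertible matrix at every point of the zero section (it is `[[1, -iB/2], [0, Q₀]]`), hence —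
  by openness of the invertible operators and compactness of the disc `‖z‖ ≤ 3` — for all
  `(z, c, t)` with `‖z‖ ≤ 3`, `‖c‖, ‖t‖ < δ` (`exists_pos_isUnit_PhiJet₀`); so on such data
  `crOp₀ = 0 ↔ crExpr = 0`, i.e. the operator detects exactly `J`-holomorphicity
  (`crOp₀_eq_zero_iff`).

## References

* C. Wendl, *Holomorphic Curves in Low Dimensions*, LNM 2216 (2018), §2.3, Thm. 2.46. [Wendl2018]
-/

noncomputable section

open Complex Set Filter Metric
open scoped Topology ContDiff
open Literature.Analysis.Complex.ProjectiveLineExpChart Literature.Geometry.Symplectic.CRExpression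
  Literature.Geometry.Symplectic.PlaneComplexStructure

namespace Literature.Geometry.Symplectic

namespace SphereCR

/-- The jet space `(z, c, c', t, t')`. [folklore] -/
abbrev Jet : Type := ℂ × ℂ × (ℂ →L[ℝ] ℂ) × ℂ × (ℂ →L[ℝ] ℂ)

namespace SphereACData

variable (𝒥 : SphereACData)

/-! ### The transport as a function of `(z, c, t)` -/

/-- The transport `Φ₀` as a function of the point data `(z, c, t)`:
`clPart (J₀ (expChart z c, Q₀(z)⁻¹ t)) diag((P z c)⁻¹, Q₀ z)`. [cite: Wendl2018, §2.3] -/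
def PhiJet₀ (z c t : ℂ) : ℂ × ℂ →L[ℝ] ℂ × ℂ :=
  clPart (𝒥.J₀ (expChart z c, 𝒥.Qinv₀ z t))
    (((((P z c)⁻¹) • ContinuousLinearMap.id ℂ ℂ).restrictScalars ℝ).prodMap (𝒥.Q₀ z))

/-- `Φ₀ ξ f z = PhiJet₀ z (ξ z) (f z)`. [folklore] -/
theorem Phi₀_eq_PhiJet₀ (ξ₀ f₀ : ℂ → ℂ) (z : ℂ) :
    𝒥.Phi₀ ξ₀ f₀ z = 𝒥.PhiJet₀ z (ξ₀ z) (f₀ z) := rfl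

/-- At the zero section the transport is `(a, b) ↦ (a - (I/2) B₀ b, Q₀ z b)`: first
component. [cite: Wendl2018, §2.3] -/
theorem PhiJet₀_zero_apply_fst (z : ℂ) (v : ℂ × ℂ) :
    (𝒥.PhiJet₀ z 0 0 v).1 = v.1 - 2⁻¹ * I * 𝒥.off₀ z v.2 := by
  rw [PhiJet₀, clPart_apply, expChart_zero, map_zero, P_zero, inv_one, one_smul]
  simp only [ContinuousLinearMap.coe_prodMap', Prod.map, ContinuousLinearMap.coe_restrictScalars',
    ContinuousLinearMap.coe_id', id_eq, 𝒥.J₀_axis_apply, Prod.smul_fst, Prod.fst_sub,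
    smul_eq_mul, Complex.real_smul, Complex.ofReal_inv, Complex.ofReal_ofNat]
  have hI : I * I = -1 := I_mul_I
  linear_combination (-(2⁻¹ * v.1)) * hI

/-- Second component: `(PhiJet₀ z 0 0 v).2 = Q₀ z v.2`. [cite: Wendl2018, §2.3] -/
theorem PhiJet₀_zero_apply_snd (z : ℂ) (v : ℂ × ℂ) :
    (𝒥.PhiJet₀ z 0 0 v).2 = 𝒥.Q₀ z v.2 := by
  rw [PhiJet₀, clPart_apply, expChart_zero, map_zero, P_zero, inv_one, one_smul]
  simp only [ContinuousLinearMap.coe_prodMap', Prod.map, ContinuousLinearMap.coe_restrictScalars',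
    ContinuousLinearMap.coe_id', id_eq, 𝒥.J₀_axis_apply, 𝒥.Q₀_nrm₀, Prod.smul_snd, Prod.snd_sub,
    smul_eq_mul, Complex.real_smul, Complex.ofReal_inv, Complex.ofReal_ofNat]
  have hI : I * I = -1 := I_mul_I
  linear_combination (-(2⁻¹ * 𝒥.Q₀ z v.2)) * hI

/-- The transport at the zero section is injective. [folklore] -/
theorem PhiJet₀_zero_injective (z : ℂ) : Function.Injective (𝒥.PhiJet₀ z 0 0) := by
  intro v v' h
  have h1 := congrArg Prod.fst h
  have h2 := congrArg Prod.snd h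
  rw [PhiJet₀_zero_apply_snd, PhiJet₀_zero_apply_snd] at h2
  have hQ : Function.Injective (𝒥.Q₀ z) := normaliser_injective (fun t => 𝒥.nrm₀_sq z t)
  have h2' : v.2 = v'.2 := hQ h2
  rw [PhiJet₀_zero_apply_fst, PhiJet₀_zero_apply_fst, h2'] at h1
  exact Prod.ext (by simpa using h1) h2'

/-- The transport at the zero section is invertible. [folklore] -/
theorem isUnit_PhiJet₀_zero (z : ℂ) : IsUnit (𝒥.PhiJet₀ z 0 0) := by
  have hbij : Function.Bijective (𝒥.PhiJet₀ z 0 0) :=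
    ⟨𝒥.PhiJet₀_zero_injective z,
      LinearMap.surjective_of_injective (f := (𝒥.PhiJet₀ z 0 0 : ℂ × ℂ →ₗ[ℝ] ℂ × ℂ))
        (𝒥.PhiJet₀_zero_injective z)⟩
  let e : (ℂ × ℂ) ≃L[ℝ] ℂ × ℂ :=
    (LinearEquiv.ofBijective (𝒥.PhiJet₀ z 0 0 : ℂ × ℂ →ₗ[ℝ] ℂ × ℂ) hbij).toContinuousLinearEquiv
  refine ⟨ContinuousLinearEquiv.toUnit e, ?_⟩
  ext v <;> rfl

/-! ### Smoothness of the ingredients on `{den ≠ 0}` -/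

/-- `P` is real-analytic, hence smooth, on `{den ≠ 0}`. [folklore] -/
theorem _root_.Literature.Geometry.Symplectic.SphereCR.contDiffAt_P {n : WithTop ℕ∞} {p : ℂ × ℂ}
    (h : den p.1 p.2 ≠ 0) : ContDiffAt ℝ n (fun q : ℂ × ℂ => P q.1 q.2) p := by
  have h1 : AnalyticAt ℝ (fun q : ℂ × ℂ => den q.1 0) p :=
    AnalyticAt.comp (g := fun q : ℂ × ℂ => den q.1 q.2) (f := fun q : ℂ × ℂ => ((q.1, 0) : ℂ × ℂ))
      (analyticAt_den _) (analyticAt_fst.prod analyticAt_const)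
  have h2 : AnalyticAt ℝ (fun q : ℂ × ℂ => den q.1 q.2) p := analyticAt_den p
  have h3 : AnalyticAt ℝ (fun q : ℂ × ℂ => (den q.1 0) ^ 2 / (den q.1 q.2) ^ 2) p :=
    (h1.pow 2).div (h2.pow 2) (pow_ne_zero 2 h)
  refine (h3.contDiffAt.congr_of_eventuallyEq ?_)
  filter_upwards with q
  rw [P, den_zero]

/-- `P⁻¹` is smooth on `{den ≠ 0}`. [folklore] -/
theorem _root_.Literature.Geometry.Symplectic.SphereCR.contDiffAt_P_inv {n : WithTop ℕ∞}
    {p : ℂ × ℂ} (h : den p.1 p.2 ≠ 0) : ContDiffAt ℝ n (fun q : ℂ × ℂ => (P q.1 q.2)⁻¹) p :=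
  (contDiffAt_P h).inv (P_ne_zero h)

/-- `(z, c, t) ↦ PhiJet₀ z c t` is smooth on `{den z c ≠ 0}`. [folklore] -/
theorem contDiffOn_PhiJet₀ :
    ContDiffOn ℝ ∞ (fun p : ℂ × ℂ × ℂ => 𝒥.PhiJet₀ p.1 p.2.1 p.2.2)
      {p | den p.1 p.2.1 ≠ 0} := by
  intro p hp
  have hp' : den (p.1, p.2.1).1 (p.1, p.2.1).2 ≠ 0 := hp
  -- the point `x = (expChart z c, Qinv₀ z t)` and `J₀ x`
  have hx : ContDiffAt ℝ ∞ (fun p : ℂ × ℂ × ℂ => ((expChart p.1 p.2.1, 𝒥.Qinv₀ p.1 p.2.2) : ℂ × ℂ))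
      p := by
    refine ContDiffAt.prodMk ?_ ?_
    · exact ContDiffAt.comp (g := fun q : ℂ × ℂ => expChart q.1 q.2)
        (f := fun x : ℂ × ℂ × ℂ => (x.1, x.2.1)) p (contDiffAt_expChart hp')
        (contDiffAt_fst.prodMk (contDiffAt_fst.comp p contDiffAt_snd))
    · exact ((𝒥.contDiff_Qinv₀_and.1.comp contDiff_fst).clm_apply
        (contDiff_snd.comp contDiff_snd)).contDiffAt
  have hJ : ContDiffAt ℝ ∞ (fun p : ℂ × ℂ × ℂ => 𝒥.J₀ (expChart p.1 p.2.1, 𝒥.Qinv₀ p.1 p.2.2)) p :=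
    𝒥.smooth₀.contDiffAt.comp p hx
  -- the matrix `diag(P⁻¹, Q₀ z)`
  have hPinv : ContDiffAt ℝ ∞ (fun p : ℂ × ℂ × ℂ => (P p.1 p.2.1)⁻¹) p :=
    ContDiffAt.comp (g := fun q : ℂ × ℂ => (P q.1 q.2)⁻¹) (f := fun x : ℂ × ℂ × ℂ => (x.1, x.2.1)) p
      (contDiffAt_P_inv hp') (contDiffAt_fst.prodMk (contDiffAt_fst.comp p contDiffAt_snd))
  have hM : ContDiffAt ℝ ∞ (fun p : ℂ × ℂ × ℂ =>
      (((((P p.1 p.2.1)⁻¹) • ContinuousLinearMap.id ℂ ℂ).restrictScalars ℝ).prodMap (𝒥.Q₀ p.1) :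
        ℂ × ℂ →L[ℝ] ℂ × ℂ)) p := by
    have h1 : ContDiffAt ℝ ∞ (fun p : ℂ × ℂ × ℂ =>
        ((((P p.1 p.2.1)⁻¹) • ContinuousLinearMap.id ℂ ℂ).restrictScalars ℝ : ℂ →L[ℝ] ℂ)) p := by
      have : (fun p : ℂ × ℂ × ℂ =>
          ((((P p.1 p.2.1)⁻¹) • ContinuousLinearMap.id ℂ ℂ).restrictScalars ℝ : ℂ →L[ℝ] ℂ)) =
          fun p => (P p.1 p.2.1)⁻¹ • ((ContinuousLinearMap.id ℂ ℂ).restrictScalars ℝ) := by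
        funext p; rfl
      rw [this]
      exact hPinv.smul contDiffAt_const
    have h2 : ContDiffAt ℝ ∞ (fun p : ℂ × ℂ × ℂ => 𝒥.Q₀ p.1) p := 𝒥.contDiff_Q₀.contDiffAt.comp p contDiffAt_fst
    exact (ContinuousLinearMap.prodMapL ℝ ℂ ℂ ℂ ℂ).contDiff.contDiffAt.comp p (h1.prodMk h2)
  -- `clPart J M = ½ (M - I • M ∘ J)` is smooth in `(J, M)`
  have hcomp : ContDiffAt ℝ ∞ (fun p : ℂ × ℂ × ℂ =>
      ((((((P p.1 p.2.1)⁻¹) • ContinuousLinearMap.id ℂ ℂ).restrictScalars ℝ).prodMap (𝒥.Q₀ p.1) :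
        ℂ × ℂ →L[ℝ] ℂ × ℂ)).comp (𝒥.J₀ (expChart p.1 p.2.1, 𝒥.Qinv₀ p.1 p.2.2))) p :=
    hM.clm_comp hJ
  unfold PhiJet₀ clPart
  exact ((hM.sub (hcomp.const_smul I)).const_smul (2⁻¹ : ℝ)).contDiffWithinAt

/-! ### Invertibility of the transport near the zero section -/

/-- **Uniform invertibility of the transport near the zero section**: there is `δ > 0` such that
for `‖z‖ ≤ 3`, `‖c‖ < δ`, `‖t‖ < δ` the denominator `den z c` is nonzero and `PhiJet₀ z c t` is
invertible (openness of the units, continuity, compactness of the disc — generalized tube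
lemma). [cite: Wendl2018, §2.3] -/
theorem exists_pos_isUnit_PhiJet₀ :
    ∃ δ : ℝ, 0 < δ ∧ ∀ z c t : ℂ, ‖z‖ ≤ 3 → ‖c‖ < δ → ‖t‖ < δ →
      den z c ≠ 0 ∧ IsUnit (𝒥.PhiJet₀ z c t) := by
  set n : Set (ℂ × (ℂ × ℂ)) := {p | den p.1 p.2.1 ≠ 0 ∧ IsUnit (𝒥.PhiJet₀ p.1 p.2.1 p.2.2)} with hn
  have hopen_den : IsOpen {p : ℂ × ℂ × ℂ | den p.1 p.2.1 ≠ 0} :=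
    isOpen_den_ne_zero.preimage (continuous_fst.prodMk (continuous_fst.comp continuous_snd))
  have hn_open : IsOpen n := by
    rw [hn]
    have hcont : ContinuousOn (fun p : ℂ × ℂ × ℂ => 𝒥.PhiJet₀ p.1 p.2.1 p.2.2)
        {p | den p.1 p.2.1 ≠ 0} := 𝒥.contDiffOn_PhiJet₀.continuousOn
    have h := hcont.isOpen_inter_preimage hopen_den Units.isOpen
    convert h using 1
    ext p
    simp only [mem_setOf_eq, mem_inter_iff, mem_preimage]
  have hsub : closedBall (0 : ℂ) 3 ×ˢ ({(0, 0)} : Set (ℂ × ℂ)) ⊆ n := by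
    rintro ⟨z, q⟩ ⟨-, hq⟩
    rw [mem_singleton_iff] at hq
    subst hq
    exact ⟨den_zero_ne_zero z, 𝒥.isUnit_PhiJet₀_zero z⟩
  obtain ⟨u, v, hu, hv, hsu, htv, huv⟩ :=
    generalized_tube_lemma (isCompact_closedBall (0 : ℂ) 3) isCompact_singleton hn_open hsub
  have h0 : ((0 : ℂ), (0 : ℂ)) ∈ v := htv (mem_singleton _)
  obtain ⟨δ, hδ, hball⟩ := Metric.isOpen_iff.1 hv _ h0
  refine ⟨δ, hδ, fun z c t hz hc ht => ?_⟩
  have hmem : ((z, (c, t)) : ℂ × (ℂ × ℂ)) ∈ n := by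
    refine huv ⟨hsu (mem_closedBall_zero_iff.2 hz), hball ?_⟩
    rw [mem_ball, Prod.dist_eq, dist_zero_right, dist_zero_right]
    exact max_lt hc ht
  exact hmem

/-- On such data the transported operator vanishes iff the Cauchy–Riemann expression does:
`crOp₀ ξ f z = 0 ↔ crExpr J₀ (vmap₀ ξ f) z = 0`. [cite: Wendl2018, Thm. 2.46] -/
theorem crOp₀_eq_zero_iff {ξ₀ f₀ : ℂ → ℂ} {z : ℂ} (hU : IsUnit (𝒥.PhiJet₀ z (ξ₀ z) (f₀ z))) :
    𝒥.crOp₀ ξ₀ f₀ z = 0 ↔ crExpr 𝒥.J₀ (𝒥.vmap₀ ξ₀ f₀) z = 0 := by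
  rw [crOp₀, Phi₀_eq_PhiJet₀]
  obtain ⟨u, hu⟩ := hU
  have hinj : Function.Injective (𝒥.PhiJet₀ z (ξ₀ z) (f₀ z)) := by
    rw [← hu]
    exact (ContinuousLinearEquiv.unitsEquiv ℝ (ℂ × ℂ) u).injective
  constructor
  · intro h
    exact hinj (h.trans (map_zero _).symm)
  · intro h
    rw [h, map_zero]

/-! ### Swapping the charts -/

/-- **The data with the two charts swapped** (the chart change `psi` is an involution whose
differential at `psi x` inverts that at `x`). All chart-`1` constructions are the chart-`0`
constructions of `𝒥.swap`, definitionally. [folklore] -/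
def swap : SphereACData where
  J₀ := 𝒥.J₁
  J₁ := 𝒥.J₀
  smooth₀ := 𝒥.smooth₁
  smooth₁ := 𝒥.smooth₀
  sq₀ := 𝒥.sq₁
  sq₁ := 𝒥.sq₀
  compat := by
    intro x hx v
    have hx' : (psi x).1 ≠ 0 := inv_ne_zero hx
    have hpp : psi (psi x) = x := by simp [psi]
    -- `dPsi (psi x) ∘ dPsi x = id`
    have hinv : ∀ w : ℂ × ℂ, dPsi (psi x) (dPsi x w) = w := fun w => by
      refine Prod.ext ?_ rfl
      simp only [dPsi_apply, psi]
      field_simp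
    have hinv' : ∀ w : ℂ × ℂ, dPsi x (dPsi (psi x) w) = w := fun w => by
      refine Prod.ext ?_ rfl
      simp only [dPsi_apply, psi]
      field_simp
    have h := 𝒥.compat (psi x) hx' (dPsi x v)
    rw [hpp, hinv] at h
    -- `h : J₀ x v… ` wait: `h : J₁ ... ` — unfold: compat (psi x) : J₁ (psi (psi x)) (dPsi (psi x) w) = dPsi (psi x) (J₀ (psi x) w)
    -- with `w = dPsi x v`: `J₁ x v = dPsi (psi x) (J₀ (psi x) (dPsi x v))`; apply `dPsi x`:
    have h2 := congrArg (dPsi x) h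
    rw [hinv'] at h2
    exact h2.symm
  axis₀ := 𝒥.axis₁
  axis₁ := 𝒥.axis₀

/-- `𝒥.swap.J₀ = 𝒥.J₁`. [folklore] -/
@[simp] theorem swap_J₀ : 𝒥.swap.J₀ = 𝒥.J₁ := rfl
/-- `𝒥.swap.J₁ = 𝒥.J₀`. [folklore] -/
@[simp] theorem swap_J₁ : 𝒥.swap.J₁ = 𝒥.J₀ := rfl
/-- The chart-`1` normaliser is the chart-`0` normaliser of the swapped data. [folklore] -/
theorem swap_Q₀ : 𝒥.swap.Q₀ = 𝒥.Q₁ := rfl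
/-- The chart-`1` inverse normaliser is the chart-`0` one of the swapped data. [folklore] -/
theorem swap_Qinv₀ : 𝒥.swap.Qinv₀ = 𝒥.Qinv₁ := rfl
/-- `vmap₁ = swap.vmap₀`. [folklore] -/
theorem swap_vmap₀ : 𝒥.swap.vmap₀ = 𝒥.vmap₁ := rfl
/-- `crOp₁ = swap.crOp₀`. [folklore] -/
theorem swap_crOp₀ : 𝒥.swap.crOp₀ = 𝒥.crOp₁ := rfl
/-- `Phi₁ = swap.Phi₀`. [folklore] -/
theorem swap_Phi₀ : 𝒥.swap.Phi₀ = 𝒥.Phi₁ := rfl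

/-- The chart-`1` transport as a function of `(w, c, t)`. [cite: Wendl2018, §2.3] -/
def PhiJet₁ (w c t : ℂ) : ℂ × ℂ →L[ℝ] ℂ × ℂ := 𝒥.swap.PhiJet₀ w c t

/-- `Φ₁ ξ f w = PhiJet₁ w (ξ w) (f w)`. [folklore] -/
theorem Phi₁_eq_PhiJet₁ (ξ₁ f₁ : ℂ → ℂ) (w : ℂ) :
    𝒥.Phi₁ ξ₁ f₁ w = 𝒥.PhiJet₁ w (ξ₁ w) (f₁ w) := rfl

/-- Uniform invertibility of the chart-`1` transport near the zero section.
[cite: Wendl2018, §2.3] -/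
theorem exists_pos_isUnit_PhiJet₁ :
    ∃ δ : ℝ, 0 < δ ∧ ∀ w c t : ℂ, ‖w‖ ≤ 3 → ‖c‖ < δ → ‖t‖ < δ →
      den w c ≠ 0 ∧ IsUnit (𝒥.PhiJet₁ w c t) :=
  𝒥.swap.exists_pos_isUnit_PhiJet₀

/-- `crOp₁ ξ f w = 0 ↔ crExpr J₁ (vmap₁ ξ f) w = 0` when the transport is invertible.
[cite: Wendl2018, Thm. 2.46] -/
theorem crOp₁_eq_zero_iff {ξ₁ f₁ : ℂ → ℂ} {w : ℂ} (hU : IsUnit (𝒥.PhiJet₁ w (ξ₁ w) (f₁ w))) :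
    𝒥.crOp₁ ξ₁ f₁ w = 0 ↔ crExpr 𝒥.J₁ (𝒥.vmap₁ ξ₁ f₁) w = 0 :=
  𝒥.swap.crOp₀_eq_zero_iff hU

/-! ### The jet form of the operator -/

/-- **The jet form of the chart-`0` operator**: the explicit function of
`(z, c, c', t, t') = (z, ξ z, Dξ(z), f z, Df(z))`. [cite: Wendl2018, Thm. 2.46] -/
def jetOp₀ (q : Jet) : ℂ × ℂ :=
  𝒥.PhiJet₀ q.1 q.2.1 q.2.2.2.1
    ((fderivExpChart (q.1, q.2.1) (1, q.2.2.1 1),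
        𝒥.Qinv₀ q.1 (q.2.2.2.2 1) + (fderiv ℝ 𝒥.Qinv₀ q.1 1) q.2.2.2.1) +
      𝒥.J₀ (expChart q.1 q.2.1, 𝒥.Qinv₀ q.1 q.2.2.2.1)
        ((fderivExpChart (q.1, q.2.1) (I, q.2.2.1 I),
          𝒥.Qinv₀ q.1 (q.2.2.2.2 I) + (fderiv ℝ 𝒥.Qinv₀ q.1 I) q.2.2.2.1)))

/-- The differential of the chart-`0` map at a point of differentiability. [folklore] -/
theorem hasFDerivAt_vmap₀ {ξ₀ f₀ : ℂ → ℂ} {z : ℂ} (hξ : DifferentiableAt ℝ ξ₀ z)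
    (hf : DifferentiableAt ℝ f₀ z) (hden : den z (ξ₀ z) ≠ 0) :
    HasFDerivAt (𝒥.vmap₀ ξ₀ f₀)
      (((fderivExpChart (z, ξ₀ z)).comp ((ContinuousLinearMap.id ℝ ℂ).prod (fderiv ℝ ξ₀ z))).prod
        ((𝒥.Qinv₀ z).comp (fderiv ℝ f₀ z) + (fderiv ℝ 𝒥.Qinv₀ z).flip (f₀ z))) z := by
  have h1 := hasFDerivAt_expChart_comp hξ.hasFDerivAt hden
  have hQ : HasFDerivAt 𝒥.Qinv₀ (fderiv ℝ 𝒥.Qinv₀ z) z :=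
    ((𝒥.contDiff_Qinv₀_and.1.differentiable (by simp)).differentiableAt).hasFDerivAt
  have h2 := hQ.clm_apply hf.hasFDerivAt
  exact h1.prodMk h2

/-- **The operator in jet form**: `crOp₀ ξ f z = jetOp₀ (z, ξ z, Dξ z, f z, Df z)` whenever
`ξ`, `f` are differentiable at `z` and `den z (ξ z) ≠ 0`. [cite: Wendl2018, Thm. 2.46] -/
theorem crOp₀_eq_jetOp₀ {ξ₀ f₀ : ℂ → ℂ} {z : ℂ} (hξ : DifferentiableAt ℝ ξ₀ z)
    (hf : DifferentiableAt ℝ f₀ z) (hden : den z (ξ₀ z) ≠ 0) :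
    𝒥.crOp₀ ξ₀ f₀ z = 𝒥.jetOp₀ (z, ξ₀ z, fderiv ℝ ξ₀ z, f₀ z, fderiv ℝ f₀ z) := by
  rw [crOp₀, Phi₀_eq_PhiJet₀, jetOp₀, crExpr_def, (𝒥.hasFDerivAt_vmap₀ hξ hf hden).fderiv]
  rfl

/-- **The jet form is smooth** on `{den z c ≠ 0}`. [folklore] -/
theorem contDiffOn_jetOp₀ : ContDiffOn ℝ ∞ 𝒥.jetOp₀ {q : Jet | den q.1 q.2.1 ≠ 0} := by
  intro q hq
  have hq' : den (q.1, q.2.1).1 (q.1, q.2.1).2 ≠ 0 := hq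
  -- projections
  have hz : ContDiffAt ℝ ∞ (fun q : Jet => q.1) q := contDiffAt_fst
  have hc : ContDiffAt ℝ ∞ (fun q : Jet => q.2.1) q := contDiffAt_fst.comp q contDiffAt_snd
  have hc' : ContDiffAt ℝ ∞ (fun q : Jet => q.2.2.1) q :=
    contDiffAt_fst.comp q (contDiffAt_snd.comp q contDiffAt_snd)
  have ht : ContDiffAt ℝ ∞ (fun q : Jet => q.2.2.2.1) q :=
    contDiffAt_fst.comp q (contDiffAt_snd.comp q (contDiffAt_snd.comp q contDiffAt_snd))
  have ht' : ContDiffAt ℝ ∞ (fun q : Jet => q.2.2.2.2) q :=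
    contDiffAt_snd.comp q (contDiffAt_snd.comp q (contDiffAt_snd.comp q contDiffAt_snd))
  have hzc : ContDiffAt ℝ ∞ (fun q : Jet => ((q.1, q.2.1) : ℂ × ℂ)) q := hz.prodMk hc
  -- `PhiJet₀ z c t`
  have hPhi : ContDiffAt ℝ ∞ (fun q : Jet => 𝒥.PhiJet₀ q.1 q.2.1 q.2.2.2.1) q := by
    have h := 𝒥.contDiffOn_PhiJet₀ (q.1, q.2.1, q.2.2.2.1) hq
    have hopen : IsOpen {p : ℂ × ℂ × ℂ | den p.1 p.2.1 ≠ 0} :=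
      isOpen_den_ne_zero.preimage (continuous_fst.prodMk (continuous_fst.comp continuous_snd))
    exact ContDiffAt.comp (g := fun p : ℂ × ℂ × ℂ => 𝒥.PhiJet₀ p.1 p.2.1 p.2.2)
      (f := fun q : Jet => (q.1, q.2.1, q.2.2.2.1)) q (h.contDiffAt (hopen.mem_nhds hq))
      (hz.prodMk (hc.prodMk ht))
  -- `x = (expChart z c, Qinv₀ z t)` and `J₀ x`
  have hx : ContDiffAt ℝ ∞ (fun q : Jet => ((expChart q.1 q.2.1, 𝒥.Qinv₀ q.1 q.2.2.2.1) : ℂ × ℂ)) q := by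
    refine ContDiffAt.prodMk ?_ ?_
    · exact ContDiffAt.comp (g := fun p : ℂ × ℂ => expChart p.1 p.2) q (contDiffAt_expChart hq') hzc
    · exact ((𝒥.contDiff_Qinv₀_and.1.contDiffAt.comp q hz).clm_apply ht)
  have hJ : ContDiffAt ℝ ∞ (fun q : Jet => 𝒥.J₀ (expChart q.1 q.2.1, 𝒥.Qinv₀ q.1 q.2.2.2.1)) q :=
    𝒥.smooth₀.contDiffAt.comp q hx
  -- `fderivExpChart (z, c)` as a smooth operator-valued function
  have hFE : ContDiffAt ℝ ∞ (fun q : Jet => fderivExpChart (q.1, q.2.1)) q := by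
    have h1 : ContDiffOn ℝ ∞ (fderiv ℝ fun p : ℂ × ℂ => expChart p.1 p.2) {p | den p.1 p.2 ≠ 0} :=
      contDiffOn_expChart.fderiv_of_isOpen isOpen_den_ne_zero le_rfl
    have h2 : ContDiffOn ℝ ∞ (fun p : ℂ × ℂ => fderivExpChart p) {p | den p.1 p.2 ≠ 0} :=
      h1.congr fun p hp => (fderiv_expChart hp).symm
    exact ((h2 _ hq').contDiffAt (isOpen_den_ne_zero.mem_nhds hq')).comp q hzc
  -- `fderiv Qinv₀ z`
  have hDQ : ContDiffAt ℝ ∞ (fun q : Jet => fderiv ℝ 𝒥.Qinv₀ q.1) q :=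
    (𝒥.contDiff_Qinv₀_and.1.fderiv_right le_rfl).contDiffAt.comp q hz
  -- the two columns of the differential
  have hcol : ∀ e : ℂ, ContDiffAt ℝ ∞ (fun q : Jet =>
      ((fderivExpChart (q.1, q.2.1) (e, q.2.2.1 e),
        𝒥.Qinv₀ q.1 (q.2.2.2.2 e) + (fderiv ℝ 𝒥.Qinv₀ q.1 e) q.2.2.2.1) : ℂ × ℂ)) q := by
    intro e
    refine ContDiffAt.prodMk ?_ ?_
    · exact hFE.clm_apply (contDiffAt_const.prodMk (hc'.clm_apply contDiffAt_const))
    · exact ((𝒥.contDiff_Qinv₀_and.1.contDiffAt.comp q hz).clm_apply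
        (ht'.clm_apply contDiffAt_const)).add ((hDQ.clm_apply contDiffAt_const).clm_apply ht)
  have hG : ContDiffAt ℝ ∞ (fun q : Jet =>
      ((fderivExpChart (q.1, q.2.1) (1, q.2.2.1 1),
        𝒥.Qinv₀ q.1 (q.2.2.2.2 1) + (fderiv ℝ 𝒥.Qinv₀ q.1 1) q.2.2.2.1) : ℂ × ℂ) +
      𝒥.J₀ (expChart q.1 q.2.1, 𝒥.Qinv₀ q.1 q.2.2.2.1)
        ((fderivExpChart (q.1, q.2.1) (I, q.2.2.1 I),
          𝒥.Qinv₀ q.1 (q.2.2.2.2 I) + (fderiv ℝ 𝒥.Qinv₀ q.1 I) q.2.2.2.1))) q :=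
    (hcol 1).add (hJ.clm_apply (hcol I))
  exact (hPhi.clm_apply hG).contDiffWithinAt

/-- The jet form of the chart-`1` operator. [cite: Wendl2018, Thm. 2.46] -/
def jetOp₁ (q : Jet) : ℂ × ℂ := 𝒥.swap.jetOp₀ q

/-- The chart-`1` operator in jet form. [cite: Wendl2018, Thm. 2.46] -/
theorem crOp₁_eq_jetOp₁ {ξ₁ f₁ : ℂ → ℂ} {w : ℂ} (hξ : DifferentiableAt ℝ ξ₁ w)
    (hf : DifferentiableAt ℝ f₁ w) (hden : den w (ξ₁ w) ≠ 0) :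
    𝒥.crOp₁ ξ₁ f₁ w = 𝒥.jetOp₁ (w, ξ₁ w, fderiv ℝ ξ₁ w, f₁ w, fderiv ℝ f₁ w) :=
  𝒥.swap.crOp₀_eq_jetOp₀ hξ hf hden

/-- The chart-`1` jet form is smooth on `{den ≠ 0}`. [folklore] -/
theorem contDiffOn_jetOp₁ : ContDiffOn ℝ ∞ 𝒥.jetOp₁ {q : Jet | den q.1 q.2.1 ≠ 0} :=
  𝒥.swap.contDiffOn_jetOp₀

/-- The zero section in jet form: `jetOp₀ (z, 0, 0, 0, 0) = 0`. [folklore] -/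
theorem jetOp₀_zero (z : ℂ) : 𝒥.jetOp₀ (z, 0, 0, 0, 0) = 0 := by
  have hv : (((fderivExpChart (z, 0) (1, (0 : ℂ →L[ℝ] ℂ) 1),
        𝒥.Qinv₀ z ((0 : ℂ →L[ℝ] ℂ) 1) + (fderiv ℝ 𝒥.Qinv₀ z 1) 0) : ℂ × ℂ) +
      𝒥.J₀ (expChart z 0, 𝒥.Qinv₀ z 0)
        ((fderivExpChart (z, 0) (I, (0 : ℂ →L[ℝ] ℂ) I),
          𝒥.Qinv₀ z ((0 : ℂ →L[ℝ] ℂ) I) + (fderiv ℝ 𝒥.Qinv₀ z I) 0))) = 0 := by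
    simp only [zero_apply, map_zero, add_zero, fderivExpChart_zero_apply,
      expChart_zero, 𝒥.axis₀, I_mul_I, Prod.mk_add_mk, add_neg_cancel]
    rfl
  show 𝒥.PhiJet₀ z 0 0 _ = 0
  rw [hv, map_zero]

end SphereACData

end SphereCR

end Literature.Geometry.Symplectic

end
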